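import Summits.KontsevichZagierPeriods.KontsevichZagierPeriods.Theorems.FermatIsogenyBetaProductSectorDefs
import Summits.KontsevichZagierPeriods.KontsevichZagierPeriods.Theorems.FermatIsogenyBetaProductSectorStubLinConstantRaw

/-!
# `BetaProductSector` (stmt-KontsevichZagierPeriods-3898), line `registered` v3 — stub `stub_linConstant`

The LIN-CONSTANT seam of the reshaped skeleton `Cruxes/BetaProductSector/Lines/registered.lean` (v3, lead c3): two Beta
atoms `(a₁,b₁)`, `(a₂,b₂)` (positive rationals) with the same Deligne–Koblitz–Ogus Hodge function
(`BetaProductSectorDefs.HodgeEqAtoms`: `{ua₁}+{ub₁}−{u(a₁+b₁)} = {ua₂}+{ub₂}−{u(a₂+b₂)}` for every `u ≥ 1` coprime to the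
four denominators) have ALGEBRAICALLY PROPORTIONAL values, `B(a₁,b₁) = c · B(a₂,b₂)` with `c > 0` real algebraic. This is the
registered signature phrased with the route vocabulary; the work is the landed Defs-free twin
`BetaProductSectorStubs.stub_linConstantRaw` (Koblitz–Ogus algebraicity of Hodge-type Γ-monomials,
`deligne_gammaMonomial_algebraic_holds`, applied to the weight-0 monomial of the quotient), of which this is the one-line
repackaging (`HodgeEqAtoms` / `hodgeTerm` unfold to the raw hypothesis verbatim).

References: P. Deligne, *Hodge cycles on abelian varieties*, LNM 900 (1982), Thm. 7.18 (Koblitz–Ogus appendix).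
-/

noncomputable section

namespace Summit.KontsevichZagierPeriods.FermatIsogeny.BetaProductSectorStubs

open Summit.KontsevichZagierPeriods.FermatIsogeny.BetaProductSectorDefs

/-- **Hodge-equal Beta atoms are algebraically proportional** (registered stub `stub_linConstant` of line `registered` v3):
if `HodgeEqAtoms a₁ b₁ a₂ b₂` then `B(a₁,b₁) = c · B(a₂,b₂)` for some real algebraic `c > 0`
(`B = ProbabilityTheory.beta`). One-line repackaging of `stub_linConstantRaw`. [cite: Deligne1982HodgeCycles, Thm. 7.18] -/
theorem stub_linConstant : ∀ (a₁ b₁ a₂ b₂ : ℚ), 0 < a₁ → 0 < b₁ → 0 < a₂ → 0 < b₂ → Summit.KontsevichZagierPeriods.FermatIsogeny.BetaProductSectorDefs.HodgeEqAtoms a₁ b₁ a₂ b₂ → ∃ c : ℝ, IsAlgebraic ℚ c ∧ 0 < c ∧ ProbabilityTheory.beta (a₁:ℝ) b₁ = c * ProbabilityTheory.beta (a₂:ℝ) b₂ :=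
  fun a₁ b₁ a₂ b₂ h₁ h₂ h₃ h₄ hH =>
    stub_linConstantRaw a₁ b₁ a₂ b₂ h₁ h₂ h₃ h₄ fun u hu c₁ c₂ c₃ c₄ => by
      simpa only [HodgeEqAtoms, hodgeTerm] using hH u hu c₁ c₂ c₃ c₄

end Summit.KontsevichZagierPeriods.FermatIsogeny.BetaProductSectorStubs

end
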